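import Literature.NumberTheory.Rogawski1990.LocalTransferAtOneOfShalikaRank              -- ★ p846802 (END F0P3a-p03 (g16)): the CONTRACT `s3id_of_shalika_of_rank_of_le_two` and its organs
import Literature.NumberTheory.Rogawski1990.LocalTransferAtOneHyperspecialOfFormTransport  -- ★ (F0P2-p02 (g12)): transport boilerplate, ★ p846358 `localTransferAtOne_transport_of_formCongr`
import Literature.NumberTheory.Automorphic.HermitianFormNonsplitPlaceFrame                 -- ★ p846818 (H2) (F0P2-p01 (g14)): `HermitianFrame.exists_formCongr_conjLocal_eq_smul_antidiag_three`
import Literature.NumberTheory.Rogawski1990.LocalTransferAtOneMuTwistGlobal                -- ★ p847599 (H1-T4) (F0P3b-p01 (g14)): `exists_nhds_localTransferAtOne_of_forall_isUnramifiedAt`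
import HarnessLib

/-!
# The identity core `S3id` AT EVERY HYPERSPECIAL-TYPE PLACE, FOR EVERY HERMITIAN FORM AND EVERY `μ`, from the Shalika germ expansion of the QUASI-SPLIT `U(Φ₃)(L⁺_v)` alone
# (Rogawski (1990) §4.9 Prop. 4.9.1, §8.1, §14.4; Langlands–Shelstad (1987) §4.2)

Topic `NumberTheory/Rogawski1990`; namespace `Literature.NumberTheory.Rogawski1990`.  THEOREMS ONLY (no definition, no instance, no notation, no named fact, no `sorry`); kernel
lane `--supports stmt-HodgeConjecture-24833`.  Cell `pub/hodgecm-mathlib`, crux H413; road «S3-tree» END STATE ∕ «S3-res» residue wording (census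
`F0/P3a/F0P3a-p06/g15/CENSUS-S3res-placeGenericity.F0P3a-p06g15.md` 314ef3bd §0.1–§0.2, §0.7: «`hH′w hH′i` is NOT residue (★ p846358 modulo (H2)); `hμ` is residue unless (H1)
lands»).  F0P3b-p01 (g14).  HONEST LABEL: HC_CM is proved only modulo the 2 remaining named inputs (hLiu418 24832, h413 24833) until rung 0 closes; nothing printed is asserted
here — the Shalika germ expansion stays a HYPOTHESIS (★ def p846293), now needed for the quasi-split form `Φ₃` only.

WHAT.  ★ p846802 `s3id_of_shalika_of_rank_of_le_two` proves the conclusion of `stub_N6nsS3id` at ONE non-split place `v` under the hyperspecial scope {`v` unramified in `L`,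
GOOD REDUCTION `hH′w hH′i` of `H′` at `w`, `μ` UNRAMIFIED at `w`, `v ∤ 2`, `H′` anisotropic, Shalika for `U(H′)_v`}.  This file removes three of the six conditions:
* §1 `s3id_of_shalika_of_rank_of_le_two_of_det` — the contract with `det H′ ≠ 0` in place of anisotropy (all its proof uses: ★ `Godement.det_ne_zero_of_anisotropic`), so that
  it can be run at the ISOTROPIC quasi-split form `Φ₃ = antidiag(1,1,1)`;
* §2 `s3id_descent_of_formCongr` — DESCENT: a `Φ₃`-side transfer-at-one statement (every Haar measure, every canonical family, every `φ₃`) holds on `U(H′)_v` for every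
  hermitian `H′` with `det H′ ≠ 0` along a local similitude (serves the S3-ram column verbatim once its contract is sorry-free);
* §3 `s3id_of_shalikaAntidiag_of_formCongr` — EVERY hermitian `H′` with `det H′ ≠ 0`, NO good-reduction hypothesis: along a local similitude `ᵗ(σT)·H′_v·T = a·Φ₃,v`
  (`e := cmDatumLocalCongr`) the contract at `Φ₃` (good reduction at every `w`: ★ `isUnit_placeForm_antidiagOne`, ★ `unit_placeForm_antidiagOne_mem_glInt`) for the
  transported data `(e⁻¹_* ν_G, e⁻¹_* m_G, φ ∘ e)` (canonical families transport: ★ `OrbitalMeasureFamily.IsCanonical.transport`) descends to `H′` by ★ p846358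
  `localTransferAtOne_transport_of_formCongr` (`Δ‴` and the orbital sums are `e`-invariant up to the sign `χ(a)`) — with Shalika assumed for `U(Φ₃)(L⁺_v)` ONLY;
* §4 `s3id_of_shalikaAntidiag` — THE END STATE at a hyperspecial-type place: the frame is SUPPLIED (★ (H2) p846818 `HermitianFrame.exists_formCongr_conjLocal_eq_smul_antidiag_three`,
  every hermitian `H′`, every non-split `w`) and «`μ_w` unramified» is DISCHARGED (★ (H1-T4) p847599 `exists_nhds_localTransferAtOne_of_forall_isUnramifiedAt`: Weil's
  extension ★ + idelic Hilbert 90 ★ p846830): for EVERY hermitian `H′` with `det H′ ≠ 0`, EVERY Hecke character `μ` with `μ|_{𝕀_{L⁺}} = ε_{L∕L⁺}`, every non-split `v`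
  unramified in `L` with `v ∤ 2`, and the canonical families: `ShalikaGermExpansionNonsplit L Φ₃ v` ⟹ the `Δ‴_v[μ]`-transfer at the identity for every `φ ∈ C_c^∞(U(H′)_v)`.
So the residual scope of `stub_N6nsS3id` after the S3-tree column is EXACTLY {`v` ramified in `L`} ∪ {`v ∣ 2`} (tonight's S3-ram wave attacks the first), and the print
input «SHALIKA» may be registered for the quasi-split `U(Φ₃)(L⁺_v)` alone.

## References
* [Rogawski1990] J. D. Rogawski, *Automorphic Representations of Unitary Groups in Three Variables*, Ann. of Math. Stud. 123 (1990): §4.9 Prop. 4.9.1 p. 55; §8.1 Props.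
  8.1.1–8.1.2 pp. 112–114; §14.4 p. 237.
* [LanglandsShelstad1987] R. P. Langlands, D. Shelstad, *On the definition of transfer factors*, Math. Ann. 278 (1987), §4.2 (transfer factors under inner twists).
* [LanglandsShelstad1990Descent] R. P. Langlands, D. Shelstad, *Descent for transfer factors*, The Grothendieck Festschrift II (1990), §2.1 (2.1.2).
* [Weil1956] A. Weil, *On a certain type of characters of the idèle-class group of an algebraic number-field* (1956), §1.
-/

set_option autoImplicit false

noncomputable section

open NumberField IsDedekindDomain MeasureTheory Measure Topology Filter
open Literature.NumberTheory.Rogawski1990 Literature.NumberTheory.Automorphic Literature.NumberTheory.GaloisRepresentations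
open Literature.NumberTheory.Automorphic.UnitaryGroup Literature.NumberTheory.Automorphic.IntegralReduction
open Literature.AlgebraicGeometry.ShimuraVarieties (unitaryGroup hermForm)
open scoped Matrix MatrixGroups Classical ValuativeRel

namespace Literature.NumberTheory.Rogawski1990

/-! ## §1 The contract with `det H′ ≠ 0` in place of anisotropy -/

/-- **★ p846802's CONTRACT WITH `det H′ ≠ 0` IN PLACE OF ANISOTROPY** (its proof uses anisotropy only through ★ `Godement.det_ne_zero_of_anisotropic`): at ONE non-split place
`v` unramified in `L`, `v ∤ 2`, for `H′` hermitian with `det H′ ≠ 0` and good reduction at `w`, `μ` unramified at `w`, canonical families, and the Shalika germ expansion for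
`U(H′)(L⁺_v)`: the `Δ‴_v[μ]`-transfer at the identity for every `φ ∈ C_c^∞`.  Verbatim re-run of the ★ proof (germ fold ★ p846423 ∘ ‹RANK› ★ ∘ span ★ p846396 ∘ head ★).
[cite: Rogawski1990, §8.1 Props. 8.1.1–8.1.2 pp. 112–114; §4.9 Prop. 4.9.1 p. 55] [cite: LanglandsShelstad1990Descent, §2.1 (2.1.2)] -/
theorem s3id_of_shalika_of_rank_of_le_two_of_det
    (L : Type) [Field L] [NumberField L] [IsCMField L] (H' : Matrix (Fin 3) (Fin 3) L) (μ : HeckeCharacter L)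
    {v : HeightOneSpectrum (𝓞 ↥(maximalRealSubfield L))}
    (hH' : (H'.map (cmConjRingHom L)).transpose = H') (w : PlacesOver L v)
    (hw : IsCMField.complexConj L • w.1 = w.1) (hv : Algebra.IsUnramifiedIn (𝓞 L) v.asIdeal)
    (hH'w : IsUnit (placeForm H' w.1)) (hH'i : hH'w.unit ∈ glInt 3 (w.1.adicCompletion L))
    (hμ : μ.IsUnramifiedAt w.1) (hμu : μ.IsUnitary)
    (hμω : ∀ x : ideleGroup ↥(maximalRealSubfield L), μ (AdeleRing.ideleBaseChange ↥(maximalRealSubfield L) L x) = quadraticHeckeCharCM L x)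
    (h2 : IsUnit (2 : 𝒪[w.1.adicCompletion L]))
    [MeasurableSpace ((cmDatum L 3 H').Local v)] [BorelSpace ((cmDatum L 3 H').Local v)]
    [∀ γ : ((cmDatum L 3 H').Local v), MeasurableSpace (((cmDatum L 3 H').Local v) ⧸ Subgroup.centralizer ({γ} : Set ((cmDatum L 3 H').Local v)))]
    [∀ γ : ((cmDatum L 3 H').Local v), BorelSpace (((cmDatum L 3 H').Local v) ⧸ Subgroup.centralizer ({γ} : Set ((cmDatum L 3 H').Local v)))]
    [MeasurableSpace ((cmDatum L 2 (Matrix.of fun i j : Fin 2 => if i.val + j.val + 1 = 2 then (1 : L) else 0)).Local v × (cmDatum L 1 (Matrix.of fun i j : Fin 1 => if i.val + j.val + 1 = 1 then (1 : L) else 0)).Local v)] [BorelSpace ((cmDatum L 2 (Matrix.of fun i j : Fin 2 => if i.val + j.val + 1 = 2 then (1 : L) else 0)).Local v × (cmDatum L 1 (Matrix.of fun i j : Fin 1 => if i.val + j.val + 1 = 1 then (1 : L) else 0)).Local v)]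
  [∀ a : (cmDatum L 2 (Matrix.of fun i j : Fin 2 => if i.val + j.val + 1 = 2 then (1 : L) else 0)).Local v × (cmDatum L 1 (Matrix.of fun i j : Fin 1 => if i.val + j.val + 1 = 1 then (1 : L) else 0)).Local v, MeasurableSpace (((cmDatum L 2 (Matrix.of fun i j : Fin 2 => if i.val + j.val + 1 = 2 then (1 : L) else 0)).Local v × (cmDatum L 1 (Matrix.of fun i j : Fin 1 => if i.val + j.val + 1 = 1 then (1 : L) else 0)).Local v) ⧸ Subgroup.centralizer ({a} : Set ((cmDatum L 2 (Matrix.of fun i j : Fin 2 => if i.val + j.val + 1 = 2 then (1 : L) else 0)).Local v × (cmDatum L 1 (Matrix.of fun i j : Fin 1 => if i.val + j.val + 1 = 1 then (1 : L) else 0)).Local v)))]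
  [∀ a : (cmDatum L 2 (Matrix.of fun i j : Fin 2 => if i.val + j.val + 1 = 2 then (1 : L) else 0)).Local v × (cmDatum L 1 (Matrix.of fun i j : Fin 1 => if i.val + j.val + 1 = 1 then (1 : L) else 0)).Local v, BorelSpace (((cmDatum L 2 (Matrix.of fun i j : Fin 2 => if i.val + j.val + 1 = 2 then (1 : L) else 0)).Local v × (cmDatum L 1 (Matrix.of fun i j : Fin 1 => if i.val + j.val + 1 = 1 then (1 : L) else 0)).Local v) ⧸ Subgroup.centralizer ({a} : Set ((cmDatum L 2 (Matrix.of fun i j : Fin 2 => if i.val + j.val + 1 = 2 then (1 : L) else 0)).Local v × (cmDatum L 1 (Matrix.of fun i j : Fin 1 => if i.val + j.val + 1 = 1 then (1 : L) else 0)).Local v)))]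
    (νH : Measure ((cmDatum L 2 (Matrix.of fun i j : Fin 2 => if i.val + j.val + 1 = 2 then (1 : L) else 0)).Local v × (cmDatum L 1 (Matrix.of fun i j : Fin 1 => if i.val + j.val + 1 = 1 then (1 : L) else 0)).Local v)) [νH.IsHaarMeasure] [νH.IsMulRightInvariant]
    (νG : Measure ((cmDatum L 3 H').Local v)) [νG.IsHaarMeasure] [νG.IsMulRightInvariant]
    {mH : OrbitalMeasureFamily ((cmDatum L 2 (Matrix.of fun i j : Fin 2 => if i.val + j.val + 1 = 2 then (1 : L) else 0)).Local v × (cmDatum L 1 (Matrix.of fun i j : Fin 1 => if i.val + j.val + 1 = 1 then (1 : L) else 0)).Local v)} {mG : OrbitalMeasureFamily ((cmDatum L 3 H').Local v)}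
    (hmH : mH.IsCanonical (IsLocalGRegular L v) νH)
    (hmG : mG.IsCanonical (fun γ => IsRegularElt (γ.val : GL (Fin 3) (UnitaryGroup.LocalRing L v))) νG)
    -- `det H′ ≠ 0` (all the letter's anisotropy is used for) and ROUTE (A)'s named input at `v`
    (hdet : H'.det ≠ 0)
    (hShalika : ShalikaGermExpansionNonsplit L H' v) :
    ∀ (φ : ((cmDatum L 3 H').Local v) → ℂ), IsLocSmooth φ →
    ∃ V ∈ 𝓝 (1 : ((cmDatum L 2 (Matrix.of fun i j : Fin 2 => if i.val + j.val + 1 = 2 then (1 : L) else 0)).Local v × (cmDatum L 1 (Matrix.of fun i j : Fin 1 => if i.val + j.val + 1 = 1 then (1 : L) else 0)).Local v)), ∃ φH : ((cmDatum L 2 (Matrix.of fun i j : Fin 2 => if i.val + j.val + 1 = 2 then (1 : L) else 0)).Local v × (cmDatum L 1 (Matrix.of fun i j : Fin 1 => if i.val + j.val + 1 = 1 then (1 : L) else 0)).Local v) → ℂ, IsLocSmooth φH ∧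
        ∀ γH ∈ V, IsLocalGRegular L v γH →
          stableOrbitalIntegralRel (IsLocalStablyConjH L v) mH φH γH =
            ∑ᶠ c : ConjClasses ((cmDatum L 3 H').Local v),
              ((finExplicitCollection L H' μ (finExplicitDelta_conj_left_all L H' μ) (finExplicitDelta_conj_right_all L H' μ)) v).Δ γH (Quotient.out c) *
                classOrbitalIntegral mG φ c := by
  intro φ hφ
  -- ROUTE (A): the germ datum at `v` for the canonical family `mG`
  obtain ⟨S, mU, Γ, hS, hmU, hRao, hgerm⟩ := hShalika mG hmG.isAdmissibleOn
  -- ‹RANK›: reference pieces of hyperspecial level ≤ 2 with an invertible unipotent table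
  obtain ⟨gref, hgs, hgK, hginv, hg2, htab⟩ := exists_levelPieces_det_classOrbitalIntegral_ne_zero L H' hH' w hw hv hH'w hH'i h2 S hS mU hmU hRao
  -- the germ fold (★ `localTransferAtOne_of_germExpansion`) with `hspan` from ★ p846396 and `htr` from the partial head
  exact localTransferAtOne_of_germExpansion L H' v hH' hdet hmH.isAdmissibleOn
    ((finExplicitCollection L H' μ (finExplicitDelta_conj_left_all L H' μ) (finExplicitDelta_conj_right_all L H' μ)) v) mG S mU Γ hgerm gref hgs
    (fun i => localTransferAtOne_of_hyperspecialLevel_le_two L H' μ hH' w hw hv hH'w hH'i hμ hμu hμω h2 νH νG hmH hmG (gref i) (hgs i) (hgK i) (hginv i) (hg2 i)) φ hφ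
    (exists_forall_classOrbitalIntegral_eq_sum_mul_of_det_ne_zero S mU gref htab φ)

/-! ## §2 DESCENT: a `Δ‴`-transfer statement at the identity for `Φ₃` holds for every hermitian form along a local similitude -/

/-- **DESCENT ALONG A LOCAL SIMILITUDE `ᵗ(σT)·H′_v·T = a·Φ₃,v`.**  If on the quasi-split `U(Φ₃)(L⁺_v)` the `Δ‴_v[μ]`-transfer at the identity holds for EVERY Haar measure,
EVERY canonical orbital-measure family and EVERY `φ₃ ∈ C_c^∞` (hypothesis `hΦ₃`, instance-generic), then it holds on `U(H′)(L⁺_v)` for every hermitian `H′` with `det H′ ≠ 0`,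
every canonical `m_G` and every `φ`: instantiate `hΦ₃` at the transported data `(e⁻¹_* ν_G, e⁻¹_* m_G, φ ∘ e)`, `e := cmDatumLocalCongr L v T ha h` (canonical families
transport: ★ `OrbitalMeasureFamily.IsCanonical.transport`; boilerplate of ★ `localTransferAtOne_of_hyperspecialLevel_le_two_of_formCongr`), and descend by ★ p846358
`localTransferAtOne_transport_of_formCongr` (`Δ‴` and the orbital sums are `e`-invariant up to the sign `χ(a) = ±1`).  Serves the hyperspecial column (§3) today and the
tame-ramified column (fold «S3-ram») verbatim. [cite: Rogawski1990, §14.4 p. 237; §4.3 (4.3.1)–(4.3.2) p. 43] [cite: LanglandsShelstad1987, §4.2] -/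
theorem s3id_descent_of_formCongr
    (L : Type) [Field L] [NumberField L] [IsCMField L] (H' : Matrix (Fin 3) (Fin 3) L) (μ : HeckeCharacter L)
    {v : HeightOneSpectrum (𝓞 ↥(maximalRealSubfield L))}
    (hH' : (H'.map (cmConjRingHom L)).transpose = H') (hdet : H'.det ≠ 0) (w : PlacesOver L v)
    (hw : IsCMField.complexConj L • w.1 = w.1)
    [MeasurableSpace ((cmDatum L 3 H').Local v)] [BorelSpace ((cmDatum L 3 H').Local v)]
    [∀ γ : ((cmDatum L 3 H').Local v), MeasurableSpace (((cmDatum L 3 H').Local v) ⧸ Subgroup.centralizer ({γ} : Set ((cmDatum L 3 H').Local v)))]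
    [∀ γ : ((cmDatum L 3 H').Local v), BorelSpace (((cmDatum L 3 H').Local v) ⧸ Subgroup.centralizer ({γ} : Set ((cmDatum L 3 H').Local v)))]
    [MeasurableSpace ((cmDatum L 2 (Matrix.of fun i j : Fin 2 => if i.val + j.val + 1 = 2 then (1 : L) else 0)).Local v × (cmDatum L 1 (Matrix.of fun i j : Fin 1 => if i.val + j.val + 1 = 1 then (1 : L) else 0)).Local v)] [BorelSpace ((cmDatum L 2 (Matrix.of fun i j : Fin 2 => if i.val + j.val + 1 = 2 then (1 : L) else 0)).Local v × (cmDatum L 1 (Matrix.of fun i j : Fin 1 => if i.val + j.val + 1 = 1 then (1 : L) else 0)).Local v)]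
  [∀ a : (cmDatum L 2 (Matrix.of fun i j : Fin 2 => if i.val + j.val + 1 = 2 then (1 : L) else 0)).Local v × (cmDatum L 1 (Matrix.of fun i j : Fin 1 => if i.val + j.val + 1 = 1 then (1 : L) else 0)).Local v, MeasurableSpace (((cmDatum L 2 (Matrix.of fun i j : Fin 2 => if i.val + j.val + 1 = 2 then (1 : L) else 0)).Local v × (cmDatum L 1 (Matrix.of fun i j : Fin 1 => if i.val + j.val + 1 = 1 then (1 : L) else 0)).Local v) ⧸ Subgroup.centralizer ({a} : Set ((cmDatum L 2 (Matrix.of fun i j : Fin 2 => if i.val + j.val + 1 = 2 then (1 : L) else 0)).Local v × (cmDatum L 1 (Matrix.of fun i j : Fin 1 => if i.val + j.val + 1 = 1 then (1 : L) else 0)).Local v)))]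
  [∀ a : (cmDatum L 2 (Matrix.of fun i j : Fin 2 => if i.val + j.val + 1 = 2 then (1 : L) else 0)).Local v × (cmDatum L 1 (Matrix.of fun i j : Fin 1 => if i.val + j.val + 1 = 1 then (1 : L) else 0)).Local v, BorelSpace (((cmDatum L 2 (Matrix.of fun i j : Fin 2 => if i.val + j.val + 1 = 2 then (1 : L) else 0)).Local v × (cmDatum L 1 (Matrix.of fun i j : Fin 1 => if i.val + j.val + 1 = 1 then (1 : L) else 0)).Local v) ⧸ Subgroup.centralizer ({a} : Set ((cmDatum L 2 (Matrix.of fun i j : Fin 2 => if i.val + j.val + 1 = 2 then (1 : L) else 0)).Local v × (cmDatum L 1 (Matrix.of fun i j : Fin 1 => if i.val + j.val + 1 = 1 then (1 : L) else 0)).Local v)))]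
    (νG : Measure ((cmDatum L 3 H').Local v)) [νG.IsHaarMeasure] [νG.IsMulRightInvariant]
    (mH : OrbitalMeasureFamily ((cmDatum L 2 (Matrix.of fun i j : Fin 2 => if i.val + j.val + 1 = 2 then (1 : L) else 0)).Local v × (cmDatum L 1 (Matrix.of fun i j : Fin 1 => if i.val + j.val + 1 = 1 then (1 : L) else 0)).Local v)) {mG : OrbitalMeasureFamily ((cmDatum L 3 H').Local v)}
    (hmG : mG.IsCanonical (fun γ => IsRegularElt (γ.val : GL (Fin 3) (UnitaryGroup.LocalRing L v))) νG)
    -- the frame: a local similitude `ᵗ(σT)·H′_v·T = a·Φ₃,v` (★ `exists_formCongr_conjLocal_eq_smul_antidiag_three`), `e := cmDatumLocalCongr L v T ha h`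
    (T : GL (Fin 3) (UnitaryGroup.LocalRing L v)) {a : UnitaryGroup.LocalRing L v} (ha : IsUnit a)
    (haσ : UnitaryGroup.conjLocal L (IsCMField.complexConj L) v a = a)
    (h : formCongr (UnitaryGroup.conjLocal L (IsCMField.complexConj L) v) T (H'.map (algebraMap L (UnitaryGroup.LocalRing L v))) =
      a • (Matrix.of fun i j : Fin 3 => if i.val + j.val + 1 = 3 then (1 : L) else 0).map (algebraMap L (UnitaryGroup.LocalRing L v)))
    -- THE Φ₃-SIDE STATEMENT: the `Δ‴_v[μ]`-transfer at the identity on `U(Φ₃)(L⁺_v)` for every Haar measure, every canonical family and every test function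
    (hΦ₃ : ∀ [MeasurableSpace ((cmDatum L 3 (Matrix.of fun i j : Fin 3 => if i.val + j.val + 1 = 3 then (1 : L) else 0)).Local v)] [BorelSpace ((cmDatum L 3 (Matrix.of fun i j : Fin 3 => if i.val + j.val + 1 = 3 then (1 : L) else 0)).Local v)]
      [∀ γ : ((cmDatum L 3 (Matrix.of fun i j : Fin 3 => if i.val + j.val + 1 = 3 then (1 : L) else 0)).Local v), MeasurableSpace (((cmDatum L 3 (Matrix.of fun i j : Fin 3 => if i.val + j.val + 1 = 3 then (1 : L) else 0)).Local v) ⧸ Subgroup.centralizer ({γ} : Set ((cmDatum L 3 (Matrix.of fun i j : Fin 3 => if i.val + j.val + 1 = 3 then (1 : L) else 0)).Local v)))]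
      [∀ γ : ((cmDatum L 3 (Matrix.of fun i j : Fin 3 => if i.val + j.val + 1 = 3 then (1 : L) else 0)).Local v), BorelSpace (((cmDatum L 3 (Matrix.of fun i j : Fin 3 => if i.val + j.val + 1 = 3 then (1 : L) else 0)).Local v) ⧸ Subgroup.centralizer ({γ} : Set ((cmDatum L 3 (Matrix.of fun i j : Fin 3 => if i.val + j.val + 1 = 3 then (1 : L) else 0)).Local v)))]
      (νG₃ : Measure ((cmDatum L 3 (Matrix.of fun i j : Fin 3 => if i.val + j.val + 1 = 3 then (1 : L) else 0)).Local v)) [νG₃.IsHaarMeasure] [νG₃.IsMulRightInvariant]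
      {mG₃ : OrbitalMeasureFamily ((cmDatum L 3 (Matrix.of fun i j : Fin 3 => if i.val + j.val + 1 = 3 then (1 : L) else 0)).Local v)},
      mG₃.IsCanonical (fun γ => IsRegularElt (γ.val : GL (Fin 3) (UnitaryGroup.LocalRing L v))) νG₃ →
      ∀ (φ₃ : ((cmDatum L 3 (Matrix.of fun i j : Fin 3 => if i.val + j.val + 1 = 3 then (1 : L) else 0)).Local v) → ℂ), IsLocSmooth φ₃ →
      ∃ V ∈ 𝓝 (1 : ((cmDatum L 2 (Matrix.of fun i j : Fin 2 => if i.val + j.val + 1 = 2 then (1 : L) else 0)).Local v × (cmDatum L 1 (Matrix.of fun i j : Fin 1 => if i.val + j.val + 1 = 1 then (1 : L) else 0)).Local v)), ∃ φH : ((cmDatum L 2 (Matrix.of fun i j : Fin 2 => if i.val + j.val + 1 = 2 then (1 : L) else 0)).Local v × (cmDatum L 1 (Matrix.of fun i j : Fin 1 => if i.val + j.val + 1 = 1 then (1 : L) else 0)).Local v) → ℂ, IsLocSmooth φH ∧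
          ∀ γH ∈ V, IsLocalGRegular L v γH →
            stableOrbitalIntegralRel (IsLocalStablyConjH L v) mH φH γH =
              ∑ᶠ c : ConjClasses ((cmDatum L 3 (Matrix.of fun i j : Fin 3 => if i.val + j.val + 1 = 3 then (1 : L) else 0)).Local v),
                ((finExplicitCollection L (Matrix.of fun i j : Fin 3 => if i.val + j.val + 1 = 3 then (1 : L) else 0) μ (finExplicitDelta_conj_left_all L (Matrix.of fun i j : Fin 3 => if i.val + j.val + 1 = 3 then (1 : L) else 0) μ) (finExplicitDelta_conj_right_all L (Matrix.of fun i j : Fin 3 => if i.val + j.val + 1 = 3 then (1 : L) else 0) μ)) v).Δ γH (Quotient.out c) *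
                  classOrbitalIntegral mG₃ φ₃ c) :
    ∀ (φ : ((cmDatum L 3 H').Local v) → ℂ), IsLocSmooth φ →
    ∃ V ∈ 𝓝 (1 : ((cmDatum L 2 (Matrix.of fun i j : Fin 2 => if i.val + j.val + 1 = 2 then (1 : L) else 0)).Local v × (cmDatum L 1 (Matrix.of fun i j : Fin 1 => if i.val + j.val + 1 = 1 then (1 : L) else 0)).Local v)), ∃ φH : ((cmDatum L 2 (Matrix.of fun i j : Fin 2 => if i.val + j.val + 1 = 2 then (1 : L) else 0)).Local v × (cmDatum L 1 (Matrix.of fun i j : Fin 1 => if i.val + j.val + 1 = 1 then (1 : L) else 0)).Local v) → ℂ, IsLocSmooth φH ∧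
        ∀ γH ∈ V, IsLocalGRegular L v γH →
          stableOrbitalIntegralRel (IsLocalStablyConjH L v) mH φH γH =
            ∑ᶠ c : ConjClasses ((cmDatum L 3 H').Local v),
              ((finExplicitCollection L H' μ (finExplicitDelta_conj_left_all L H' μ) (finExplicitDelta_conj_right_all L H' μ)) v).Δ γH (Quotient.out c) *
                classOrbitalIntegral mG φ c := by
  intro φ hφ
  -- Borel structures on the `Φ₃` side
  letI iM : MeasurableSpace ((cmDatum L 3 (Matrix.of fun i j : Fin 3 => if i.val + j.val + 1 = 3 then (1 : L) else 0)).Local v) := borel _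
  haveI iB : BorelSpace ((cmDatum L 3 (Matrix.of fun i j : Fin 3 => if i.val + j.val + 1 = 3 then (1 : L) else 0)).Local v) := ⟨rfl⟩
  letI iMq : ∀ γ : (cmDatum L 3 (Matrix.of fun i j : Fin 3 => if i.val + j.val + 1 = 3 then (1 : L) else 0)).Local v,
      MeasurableSpace ((cmDatum L 3 (Matrix.of fun i j : Fin 3 => if i.val + j.val + 1 = 3 then (1 : L) else 0)).Local v ⧸
        Subgroup.centralizer ({γ} : Set ((cmDatum L 3 (Matrix.of fun i j : Fin 3 => if i.val + j.val + 1 = 3 then (1 : L) else 0)).Local v))) :=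
    fun _ => borel _
  haveI iBq : ∀ γ : (cmDatum L 3 (Matrix.of fun i j : Fin 3 => if i.val + j.val + 1 = 3 then (1 : L) else 0)).Local v,
      BorelSpace ((cmDatum L 3 (Matrix.of fun i j : Fin 3 => if i.val + j.val + 1 = 3 then (1 : L) else 0)).Local v ⧸
        Subgroup.centralizer ({γ} : Set ((cmDatum L 3 (Matrix.of fun i j : Fin 3 => if i.val + j.val + 1 = 3 then (1 : L) else 0)).Local v))) :=
    fun _ => ⟨rfl⟩
  -- the transported Haar measure on `U(Φ₃)_v`
  haveI : (νG.map (UnitaryGroup.cmDatumLocalCongr L v T ha h).symm).IsMulRightInvariant :=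
    Literature.MeasureTheory.Group.isMulRightInvariant_map_mulEquiv_of_isMulRightInvariant (UnitaryGroup.cmDatumLocalCongr L v T ha h).symm.toMulEquiv
      (UnitaryGroup.cmDatumLocalCongr L v T ha h).symm.continuous.measurable νG
  -- class preservation along `e`: regularity transports, the canonical family transports
  have hcl' : ∀ γ : (cmDatum L 3 (Matrix.of fun i j : Fin 3 => if i.val + j.val + 1 = 3 then (1 : L) else 0)).Local v,
      Corresponds (UnitaryGroup.conjLocal L (IsCMField.complexConj L) v) ((UnitaryGroup.adelicForm L 3 H').map (UnitaryGroup.adeleToLocal L v))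
        ((UnitaryGroup.adelicForm L 3 (Matrix.of fun i j : Fin 3 => if i.val + j.val + 1 = 3 then (1 : L) else 0)).map (UnitaryGroup.adeleToLocal L v))
        ((UnitaryGroup.cmDatumLocalCongr L v T ha h) γ) γ :=
    fun γ => corresponds_comm.1 (corresponds_cmDatumLocalCongr L v T ha h γ)
  have hmGΦ : (mG.transport (UnitaryGroup.cmDatumLocalCongr L v T ha h).symm.toMulEquiv (UnitaryGroup.cmDatumLocalCongr L v T ha h).symm.continuous
      (UnitaryGroup.cmDatumLocalCongr L v T ha h).continuous).IsCanonical
        (fun γ => IsRegularElt (γ.val : GL (Fin 3) (UnitaryGroup.LocalRing L v))) (νG.map (UnitaryGroup.cmDatumLocalCongr L v T ha h).symm) :=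
    hmG.transport (UnitaryGroup.cmDatumLocalCongr L v T ha h).symm.toMulEquiv (UnitaryGroup.cmDatumLocalCongr L v T ha h).symm.continuous
      (UnitaryGroup.cmDatumLocalCongr L v T ha h).continuous (fun _ _ hbb' => isRegularElt_iff_of_isConj_local L H' v hbb')
      (fun γ hγ => isRegularElt_of_isConj (hcl' γ).symm hγ) νG (νG.map (UnitaryGroup.cmDatumLocalCongr L v T ha h).symm) rfl
  -- the test function `φ ∘ e` on `U(Φ₃)_v` is `C_c^∞`
  have hcont : Continuous fun x => (UnitaryGroup.cmDatumLocalCongr L v T ha h) x := (UnitaryGroup.cmDatumLocalCongr L v T ha h).continuous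
  have hsm : IsLocSmooth (φ ∘ (UnitaryGroup.cmDatumLocalCongr L v T ha h)) :=
    ⟨hφ.1.comp_continuous hcont, hφ.2.comp_homeomorph (UnitaryGroup.cmDatumLocalCongr L v T ha h).toHomeomorph⟩
  -- the `Φ₃`-side statement for the transported data, then the transport ★ `localTransferAtOne_transport_of_formCongr`
  have hΦ := hΦ₃ (νG.map (UnitaryGroup.cmDatumLocalCongr L v T ha h).symm) hmGΦ (φ ∘ (UnitaryGroup.cmDatumLocalCongr L v T ha h)) hsm
  exact localTransferAtOne_transport_of_formCongr L v H' T ha h w hw hH' hdet haσ μ mH mG φ hΦ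

/-! ## §3 Every hermitian form along a local similitude to `Φ₃` (Shalika for `U(Φ₃)_v` only) -/

/-- **`S3id` AT A HYPERSPECIAL-TYPE PLACE FOR EVERY HERMITIAN `H′` (`det H′ ≠ 0`, NO good-reduction hypothesis) along a local similitude `ᵗ(σT)·H′_v·T = a·Φ₃,v`**,
`μ` unramified at `w`, Shalika assumed for the quasi-split `U(Φ₃)(L⁺_v)` only: §1 at `Φ₃` (good reduction at every `w`) fed to the DESCENT §2. [cite: Rogawski1990, §14.4 p. 237; §4.9 Prop. 4.9.1 p. 55] [cite: LanglandsShelstad1987, §4.2] -/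
theorem s3id_of_shalikaAntidiag_of_formCongr
    (L : Type) [Field L] [NumberField L] [IsCMField L] (H' : Matrix (Fin 3) (Fin 3) L) (μ : HeckeCharacter L)
    {v : HeightOneSpectrum (𝓞 ↥(maximalRealSubfield L))}
    (hH' : (H'.map (cmConjRingHom L)).transpose = H') (hdet : H'.det ≠ 0) (w : PlacesOver L v)
    (hw : IsCMField.complexConj L • w.1 = w.1) (hv : Algebra.IsUnramifiedIn (𝓞 L) v.asIdeal)
    (hμ : μ.IsUnramifiedAt w.1) (hμu : μ.IsUnitary)
    (hμω : ∀ x : ideleGroup ↥(maximalRealSubfield L), μ (AdeleRing.ideleBaseChange ↥(maximalRealSubfield L) L x) = quadraticHeckeCharCM L x)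
    (h2 : IsUnit (2 : 𝒪[w.1.adicCompletion L]))
    [MeasurableSpace ((cmDatum L 3 H').Local v)] [BorelSpace ((cmDatum L 3 H').Local v)]
    [∀ γ : ((cmDatum L 3 H').Local v), MeasurableSpace (((cmDatum L 3 H').Local v) ⧸ Subgroup.centralizer ({γ} : Set ((cmDatum L 3 H').Local v)))]
    [∀ γ : ((cmDatum L 3 H').Local v), BorelSpace (((cmDatum L 3 H').Local v) ⧸ Subgroup.centralizer ({γ} : Set ((cmDatum L 3 H').Local v)))]
    [MeasurableSpace ((cmDatum L 2 (Matrix.of fun i j : Fin 2 => if i.val + j.val + 1 = 2 then (1 : L) else 0)).Local v × (cmDatum L 1 (Matrix.of fun i j : Fin 1 => if i.val + j.val + 1 = 1 then (1 : L) else 0)).Local v)] [BorelSpace ((cmDatum L 2 (Matrix.of fun i j : Fin 2 => if i.val + j.val + 1 = 2 then (1 : L) else 0)).Local v × (cmDatum L 1 (Matrix.of fun i j : Fin 1 => if i.val + j.val + 1 = 1 then (1 : L) else 0)).Local v)]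
  [∀ a : (cmDatum L 2 (Matrix.of fun i j : Fin 2 => if i.val + j.val + 1 = 2 then (1 : L) else 0)).Local v × (cmDatum L 1 (Matrix.of fun i j : Fin 1 => if i.val + j.val + 1 = 1 then (1 : L) else 0)).Local v, MeasurableSpace (((cmDatum L 2 (Matrix.of fun i j : Fin 2 => if i.val + j.val + 1 = 2 then (1 : L) else 0)).Local v × (cmDatum L 1 (Matrix.of fun i j : Fin 1 => if i.val + j.val + 1 = 1 then (1 : L) else 0)).Local v) ⧸ Subgroup.centralizer ({a} : Set ((cmDatum L 2 (Matrix.of fun i j : Fin 2 => if i.val + j.val + 1 = 2 then (1 : L) else 0)).Local v × (cmDatum L 1 (Matrix.of fun i j : Fin 1 => if i.val + j.val + 1 = 1 then (1 : L) else 0)).Local v)))]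
  [∀ a : (cmDatum L 2 (Matrix.of fun i j : Fin 2 => if i.val + j.val + 1 = 2 then (1 : L) else 0)).Local v × (cmDatum L 1 (Matrix.of fun i j : Fin 1 => if i.val + j.val + 1 = 1 then (1 : L) else 0)).Local v, BorelSpace (((cmDatum L 2 (Matrix.of fun i j : Fin 2 => if i.val + j.val + 1 = 2 then (1 : L) else 0)).Local v × (cmDatum L 1 (Matrix.of fun i j : Fin 1 => if i.val + j.val + 1 = 1 then (1 : L) else 0)).Local v) ⧸ Subgroup.centralizer ({a} : Set ((cmDatum L 2 (Matrix.of fun i j : Fin 2 => if i.val + j.val + 1 = 2 then (1 : L) else 0)).Local v × (cmDatum L 1 (Matrix.of fun i j : Fin 1 => if i.val + j.val + 1 = 1 then (1 : L) else 0)).Local v)))]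
    (νH : Measure ((cmDatum L 2 (Matrix.of fun i j : Fin 2 => if i.val + j.val + 1 = 2 then (1 : L) else 0)).Local v × (cmDatum L 1 (Matrix.of fun i j : Fin 1 => if i.val + j.val + 1 = 1 then (1 : L) else 0)).Local v)) [νH.IsHaarMeasure] [νH.IsMulRightInvariant]
    (νG : Measure ((cmDatum L 3 H').Local v)) [νG.IsHaarMeasure] [νG.IsMulRightInvariant]
    {mH : OrbitalMeasureFamily ((cmDatum L 2 (Matrix.of fun i j : Fin 2 => if i.val + j.val + 1 = 2 then (1 : L) else 0)).Local v × (cmDatum L 1 (Matrix.of fun i j : Fin 1 => if i.val + j.val + 1 = 1 then (1 : L) else 0)).Local v)} {mG : OrbitalMeasureFamily ((cmDatum L 3 H').Local v)}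
    (hmH : mH.IsCanonical (IsLocalGRegular L v) νH)
    (hmG : mG.IsCanonical (fun γ => IsRegularElt (γ.val : GL (Fin 3) (UnitaryGroup.LocalRing L v))) νG)
    -- the frame: a local similitude `ᵗ(σT)·H′_v·T = a·Φ₃,v` (★ `exists_formCongr_conjLocal_eq_smul_antidiag_three`), `e := cmDatumLocalCongr L v T ha h`
    (T : GL (Fin 3) (UnitaryGroup.LocalRing L v)) {a : UnitaryGroup.LocalRing L v} (ha : IsUnit a)
    (haσ : UnitaryGroup.conjLocal L (IsCMField.complexConj L) v a = a)
    (h : formCongr (UnitaryGroup.conjLocal L (IsCMField.complexConj L) v) T (H'.map (algebraMap L (UnitaryGroup.LocalRing L v))) =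
      a • (Matrix.of fun i j : Fin 3 => if i.val + j.val + 1 = 3 then (1 : L) else 0).map (algebraMap L (UnitaryGroup.LocalRing L v)))
    -- ROUTE (A)'s named input at `v` FOR THE QUASI-SPLIT FORM `Φ₃` only
    (hShalika : ShalikaGermExpansionNonsplit L (Matrix.of fun i j : Fin 3 => if i.val + j.val + 1 = 3 then (1 : L) else 0) v) :
    ∀ (φ : ((cmDatum L 3 H').Local v) → ℂ), IsLocSmooth φ →
    ∃ V ∈ 𝓝 (1 : ((cmDatum L 2 (Matrix.of fun i j : Fin 2 => if i.val + j.val + 1 = 2 then (1 : L) else 0)).Local v × (cmDatum L 1 (Matrix.of fun i j : Fin 1 => if i.val + j.val + 1 = 1 then (1 : L) else 0)).Local v)), ∃ φH : ((cmDatum L 2 (Matrix.of fun i j : Fin 2 => if i.val + j.val + 1 = 2 then (1 : L) else 0)).Local v × (cmDatum L 1 (Matrix.of fun i j : Fin 1 => if i.val + j.val + 1 = 1 then (1 : L) else 0)).Local v) → ℂ, IsLocSmooth φH ∧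
        ∀ γH ∈ V, IsLocalGRegular L v γH →
          stableOrbitalIntegralRel (IsLocalStablyConjH L v) mH φH γH =
            ∑ᶠ c : ConjClasses ((cmDatum L 3 H').Local v),
              ((finExplicitCollection L H' μ (finExplicitDelta_conj_left_all L H' μ) (finExplicitDelta_conj_right_all L H' μ)) v).Δ γH (Quotient.out c) *
                classOrbitalIntegral mG φ c := by
  intro φ hφ
  refine s3id_descent_of_formCongr L H' μ hH' hdet w hw νG mH hmG T ha haσ h ?_ φ hφ
  intro _ _ _ _ νG₃ _ _ mG₃ hmG₃ φ₃ hφ₃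
  -- §1 at `Φ₃`: good reduction at every `w` (★ `isUnit_placeForm_antidiagOne`, ★ `unit_placeForm_antidiagOne_mem_glInt`), `det Φ₃ ≠ 0`
  exact s3id_of_shalika_of_rank_of_le_two_of_det L (Matrix.of fun i j : Fin 3 => if i.val + j.val + 1 = 3 then (1 : L) else 0) μ
    (antidiagOne_isHermitian L 3) w hw hv (isUnit_placeForm_antidiagOne 3 w.1) (unit_placeForm_antidiagOne_mem_glInt 3 w.1) hμ hμu hμω h2 νH νG₃ hmH hmG₃
    (isUnit_antidiagOne_det L 3).ne_zero hShalika φ₃ hφ₃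

/-! ## §4 The end state at a hyperspecial-type place: every form, every `μ` -/

/-- **`S3id` AT EVERY HYPERSPECIAL-TYPE PLACE, FOR EVERY HERMITIAN FORM AND EVERY `μ` OF THE LETTER, FROM SHALIKA FOR `U(Φ₃)(L⁺_v)` ALONE.**  For `H′` hermitian with
`det H′ ≠ 0`, `μ` ANY Hecke character of `L` with `μ|_{𝕀_{L⁺}} = ε_{L∕L⁺}`, `v` non-split, unramified in `L`, `v ∤ 2`, canonical families: the frame comes from ★ (H2) p846818,
the «`μ_w` unramified» hypothesis of §3 is discharged by ★ (H1-T4) p847599 (a unitary `μ₀` of the class unramified at `w` exists; the transfer twists along `μ ↦ μ₀`).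
Residual scope of `stub_N6nsS3id` after this theorem: {`v` ramified in `L`} ∪ {`v ∣ 2`}. [cite: Rogawski1990, §4.9 Prop. 4.9.1 p. 55; §14.4 p. 237] [cite: LanglandsShelstad1987, §4.2]
[cite: Weil1956, §1] [cite: LanglandsShelstad1990Descent, §2.1 (2.1.2)] -/
theorem s3id_of_shalikaAntidiag
    (L : Type) [Field L] [NumberField L] [IsCMField L] (H' : Matrix (Fin 3) (Fin 3) L) (μ : HeckeCharacter L)
    {v : HeightOneSpectrum (𝓞 ↥(maximalRealSubfield L))}
    (hH' : (H'.map (cmConjRingHom L)).transpose = H') (hdet : H'.det ≠ 0) (w : PlacesOver L v)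
    (hw : IsCMField.complexConj L • w.1 = w.1) (hv : Algebra.IsUnramifiedIn (𝓞 L) v.asIdeal)
    (hμω : ∀ x : ideleGroup ↥(maximalRealSubfield L), μ (AdeleRing.ideleBaseChange ↥(maximalRealSubfield L) L x) = quadraticHeckeCharCM L x)
    (h2 : IsUnit (2 : 𝒪[w.1.adicCompletion L]))
    [MeasurableSpace ((cmDatum L 3 H').Local v)] [BorelSpace ((cmDatum L 3 H').Local v)]
    [∀ γ : ((cmDatum L 3 H').Local v), MeasurableSpace (((cmDatum L 3 H').Local v) ⧸ Subgroup.centralizer ({γ} : Set ((cmDatum L 3 H').Local v)))]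
    [∀ γ : ((cmDatum L 3 H').Local v), BorelSpace (((cmDatum L 3 H').Local v) ⧸ Subgroup.centralizer ({γ} : Set ((cmDatum L 3 H').Local v)))]
    [MeasurableSpace ((cmDatum L 2 (Matrix.of fun i j : Fin 2 => if i.val + j.val + 1 = 2 then (1 : L) else 0)).Local v × (cmDatum L 1 (Matrix.of fun i j : Fin 1 => if i.val + j.val + 1 = 1 then (1 : L) else 0)).Local v)] [BorelSpace ((cmDatum L 2 (Matrix.of fun i j : Fin 2 => if i.val + j.val + 1 = 2 then (1 : L) else 0)).Local v × (cmDatum L 1 (Matrix.of fun i j : Fin 1 => if i.val + j.val + 1 = 1 then (1 : L) else 0)).Local v)]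
  [∀ a : (cmDatum L 2 (Matrix.of fun i j : Fin 2 => if i.val + j.val + 1 = 2 then (1 : L) else 0)).Local v × (cmDatum L 1 (Matrix.of fun i j : Fin 1 => if i.val + j.val + 1 = 1 then (1 : L) else 0)).Local v, MeasurableSpace (((cmDatum L 2 (Matrix.of fun i j : Fin 2 => if i.val + j.val + 1 = 2 then (1 : L) else 0)).Local v × (cmDatum L 1 (Matrix.of fun i j : Fin 1 => if i.val + j.val + 1 = 1 then (1 : L) else 0)).Local v) ⧸ Subgroup.centralizer ({a} : Set ((cmDatum L 2 (Matrix.of fun i j : Fin 2 => if i.val + j.val + 1 = 2 then (1 : L) else 0)).Local v × (cmDatum L 1 (Matrix.of fun i j : Fin 1 => if i.val + j.val + 1 = 1 then (1 : L) else 0)).Local v)))]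
  [∀ a : (cmDatum L 2 (Matrix.of fun i j : Fin 2 => if i.val + j.val + 1 = 2 then (1 : L) else 0)).Local v × (cmDatum L 1 (Matrix.of fun i j : Fin 1 => if i.val + j.val + 1 = 1 then (1 : L) else 0)).Local v, BorelSpace (((cmDatum L 2 (Matrix.of fun i j : Fin 2 => if i.val + j.val + 1 = 2 then (1 : L) else 0)).Local v × (cmDatum L 1 (Matrix.of fun i j : Fin 1 => if i.val + j.val + 1 = 1 then (1 : L) else 0)).Local v) ⧸ Subgroup.centralizer ({a} : Set ((cmDatum L 2 (Matrix.of fun i j : Fin 2 => if i.val + j.val + 1 = 2 then (1 : L) else 0)).Local v × (cmDatum L 1 (Matrix.of fun i j : Fin 1 => if i.val + j.val + 1 = 1 then (1 : L) else 0)).Local v)))]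
    (νH : Measure ((cmDatum L 2 (Matrix.of fun i j : Fin 2 => if i.val + j.val + 1 = 2 then (1 : L) else 0)).Local v × (cmDatum L 1 (Matrix.of fun i j : Fin 1 => if i.val + j.val + 1 = 1 then (1 : L) else 0)).Local v)) [νH.IsHaarMeasure] [νH.IsMulRightInvariant]
    (νG : Measure ((cmDatum L 3 H').Local v)) [νG.IsHaarMeasure] [νG.IsMulRightInvariant]
    {mH : OrbitalMeasureFamily ((cmDatum L 2 (Matrix.of fun i j : Fin 2 => if i.val + j.val + 1 = 2 then (1 : L) else 0)).Local v × (cmDatum L 1 (Matrix.of fun i j : Fin 1 => if i.val + j.val + 1 = 1 then (1 : L) else 0)).Local v)} {mG : OrbitalMeasureFamily ((cmDatum L 3 H').Local v)}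
    (hmH : mH.IsCanonical (IsLocalGRegular L v) νH)
    (hmG : mG.IsCanonical (fun γ => IsRegularElt (γ.val : GL (Fin 3) (UnitaryGroup.LocalRing L v))) νG)
    -- ROUTE (A)'s named input at `v` FOR THE QUASI-SPLIT FORM `Φ₃` only
    (hShalika : ShalikaGermExpansionNonsplit L (Matrix.of fun i j : Fin 3 => if i.val + j.val + 1 = 3 then (1 : L) else 0) v) :
    ∀ (φ : ((cmDatum L 3 H').Local v) → ℂ), IsLocSmooth φ →
    ∃ V ∈ 𝓝 (1 : ((cmDatum L 2 (Matrix.of fun i j : Fin 2 => if i.val + j.val + 1 = 2 then (1 : L) else 0)).Local v × (cmDatum L 1 (Matrix.of fun i j : Fin 1 => if i.val + j.val + 1 = 1 then (1 : L) else 0)).Local v)), ∃ φH : ((cmDatum L 2 (Matrix.of fun i j : Fin 2 => if i.val + j.val + 1 = 2 then (1 : L) else 0)).Local v × (cmDatum L 1 (Matrix.of fun i j : Fin 1 => if i.val + j.val + 1 = 1 then (1 : L) else 0)).Local v) → ℂ, IsLocSmooth φH ∧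
        ∀ γH ∈ V, IsLocalGRegular L v γH →
          stableOrbitalIntegralRel (IsLocalStablyConjH L v) mH φH γH =
            ∑ᶠ c : ConjClasses ((cmDatum L 3 H').Local v),
              ((finExplicitCollection L H' μ (finExplicitDelta_conj_left_all L H' μ) (finExplicitDelta_conj_right_all L H' μ)) v).Δ γH (Quotient.out c) *
                classOrbitalIntegral mG φ c := by
  intro φ hφ
  -- the frame at the non-split place (★ (H2) `HermitianFrame.exists_formCongr_conjLocal_eq_smul_antidiag_three`)
  obtain ⟨T, a, ha, haσ, h⟩ := HermitianFrame.exists_formCongr_conjLocal_eq_smul_antidiag_three L H' hH' hdet w hw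
  -- the «`μ_w` unramified» hypothesis discharged by ★ (H1-T4) `exists_nhds_localTransferAtOne_of_forall_isUnramifiedAt`
  exact exists_nhds_localTransferAtOne_of_forall_isUnramifiedAt L H' w hw hv mH mG φ
    (fun μ₀ hμ₀u hμ₀ω hμ₀ => s3id_of_shalikaAntidiag_of_formCongr L H' μ₀ hH' hdet w hw hv hμ₀ hμ₀u hμ₀ω h2 νH νG hmH hmG T ha haσ h hShalika φ hφ)
    μ hμω

end Literature.NumberTheory.Rogawski1990

end
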